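import Literature.NumberTheory.Sieve.HeathBrownCubicMertensK
import Literature.NumberTheory.Sieve.HeathBrownCubicRegulator
import HarnessLib

/-!
# Heath-Brown 2001 (PLMS), Lemma 9: `∏_{p < x} (1 − g(p)/p) ∼ C₃ / log x` for `K = ℚ(∛2)`

Topic `Literature/NumberTheory/Sieve`; a PROVED analytic layer (no named facts) under the named facts
`Irving2015_largestPrimeFactor_cubic` / `HeathBrown2001_largestPrimeFactor_cubic`
(`LargestPrimeFactorCubic.lean`), continuing `LargestPrimeFactorCubicKProduct.lean` (this seat takes
the MAIN TERM `S₀` of Heath-Brown's sieve with his printed constants: Lemmas 6–9 of D. R. Heath-Brown,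
*The largest prime factor of `X³ + 2`*, Proc. London Math. Soc. (3) 82 (2001) 554–596).

**Lemma 9** (p. 11 of the held text `paper:heathbrown2001-largest-prime-factor-i-x-i-sup`):
"We have `∏_{p ≤ x} (1 − g(p)/p) ∼ C₃/log x`, where
`C₃ = (√27/(e^γ π log ε₀)) ∏_p {(1 − g(p)/p) ∏_{N(P) = p} (1 − 1/N(P))⁻¹}`."
Here `g(p) = #{P : N(P) = p}` (Lemma 6, p. 10) is the number of first-degree primes of `K = ℚ(∛2)`
above `p`, `ε₀ = 1 + ∛2 + ∛4` the fundamental unit, and the inner product runs over all primes `P` of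
`K` above `p` (so that the `p`-factor is `1 + O(p⁻²)`; with the degree-one primes only the product
would diverge — the display's subscript is read accordingly, and this reading is the one that makes
`C₂C₃ = (log 2)(log 4/3)/(3π²) ∏ k(p)` on p. 12 come out, cf. `k(p) = (1 − p⁻³)⁻¹` at inert `p`).
It is Mertens' theorem for `K` (residue `γ₀ = ρ_K = π log ε₀/√27` of `ζ_K` at `1`) regrouped.

## What is proved (namespace `Literature.NumberTheory.Sieve.HeathBrown2001`)

* `gFactor p = 1 − g(p)/p` with `g = CubicPrimes.cubeRootTwoCount` (`= #{P : N(P) = p}` at primes,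
  tree `CubicSieve.card_primesAbove_filter_absNorm_eq`); `gProd x = ∏_{p < x} (1 − g(p)/p)`
  (`Nat.primesBelow ⌈x⌉₊` is exactly the set of primes `< x`; Lemma 8 uses `∏_{p < X^δ}`);
* `rFactor p = (1 − g(p)/p) / ∏_{P ∣ p}(1 − N(P)⁻¹)`, `rProd N = ∏_{p < N} rFactor p`,
  `Rinf = exp(∑_p log rFactor p)`: **`tendsto_rProd`** — the Euler product `∏_p rFactor p`
  converges to `Rinf > 0` (`|log rFactor p| ≤ 24/p²` for `p ≥ 7`, `abs_log_rFactor_le`, from the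
  tree's `CubicSieve.rTerm_bounds` and `neg_log_one_sub_bounds`);
* **`tendsto_gProd_mul_log`** (Lemma 9): `(∏_{p<x}(1 − g(p)/p)) · log x → C₃ := Rinf/(e^γ γ₀)`
  as `x → ∞`, from the tree's Mertens theorem for `K` grouped by rational primes
  (`CubicSieve.mertensK_grouped`: `∏_{p<z}∏_{P∣p}(1 − N(P)⁻¹) · e^γ γ₀ log z = 1 + O(1/log z)`);
* `C3_eq` — the printed shape of the constant: `Rinf/(e^γ γ₀) = √27/(e^γ π log ε₀) · Rinf`
  (`CubicSieve.gamma₀_eq : γ₀ = π log ε₀/(3√3)`, `ε₀ = CubicSieve.unitE`, `log ε₀ = R_K` by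
  `CubicSieve.regulator_eq_log_unitE`).

Printed `∼` is rendered as a `Tendsto` (no rate is claimed in Lemma 9; the inputs carry
`O(1/log x)` and `O(1/x)` rates should a later layer need them).

## References

* D. R. Heath-Brown, *The largest prime factor of `X³ + 2`*, Proc. London Math. Soc. (3) 82 (2001)
  554–596, doi:10.1112/plms/82.3.554, Lemma 9 (p. 11), Lemma 6 (p. 10, `g(p)`), §8.
  [`HeathBrown2001LargestPrimeFactorCubic`]
* M. Rosen, *A generalization of Mertens' theorem*, J. Ramanujan Math. Soc. 14 (1999) 1–19, Thm. 2
  (the input, via the tree). [`Rosen1999Mertens`]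

## Mathlib / tree search

Tree (all in `HeathBrownCubicMertensK` / `…NormWindowSieve` / `…Regulator` / `…SieveSetup`):
`CubicSieve.mertensK_grouped`, `normDensityAt`, `one_sub_normDensityAt_bounds`,
`one_sub_normDensityAt_eq_exp`, `bTerm`, `rTerm`, `rTerm_bounds`, `neg_log_one_sub_bounds`,
`gamma₀`, `gamma₀_pos`, `gamma₀_eq`, `CubicPrimes.cubeRootTwoCount_le_three/_two/_three`.
Mathlib: `Summable.of_norm_bounded_eventually_nat`, `HasSum.tendsto_sum_nat`, `tendsto_nat_ceil_atTop`,
`squeeze_zero_norm'`, `Filter.Tendsto.div_atTop`, `Real.tendsto_log_atTop`.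
`lean search 'gProd|rFactor|Rinf|Lemma 9'`: no prior formalization of this lemma.
-/

noncomputable section

open Finset Filter Topology

namespace Literature.NumberTheory.Sieve.HeathBrown2001

open CubicPrimes (cubeRootTwoCount cubeRootTwoCount_le_three cubeRootTwoCount_two cubeRootTwoCount_three)
open CubicSieve

/-! ### The factors -/

/-- `1 − g(p)/p`, `g(p) = #{P : N(P) = p}` read as the number of cube roots of `2` modulo `p`.
[cite: HeathBrown2001LargestPrimeFactorCubic, Lemma 6 (g) and Lemma 9] -/
def gFactor (p : ℕ) : ℝ := 1 - (cubeRootTwoCount p : ℝ) / p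

/-- `∏_{p < x} (1 − g(p)/p)` (the product of Lemma 8; `Nat.primesBelow ⌈x⌉₊ = {p prime : p < x}`).
[cite: HeathBrown2001LargestPrimeFactorCubic, Lemmas 8–9] -/
def gProd (x : ℝ) : ℝ := ∏ p ∈ Nat.primesBelow ⌈x⌉₊, gFactor p

/-- The regrouping factor `r(p) = (1 − g(p)/p) / ∏_{P ∣ p} (1 − N(P)⁻¹)` (`= 1 + O(p⁻²)`), whose Euler
product is the last factor of `C₃`. [cite: HeathBrown2001LargestPrimeFactorCubic, Lemma 9 (C₃)] -/
def rFactor (p : ℕ) : ℝ := gFactor p / (1 - normDensityAt p)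

/-- Partial Euler products `∏_{p < N} r(p)`. [cite: HeathBrown2001LargestPrimeFactorCubic, Lemma 9 (C₃)] -/
def rProd (N : ℕ) : ℝ := ∏ p ∈ Nat.primesBelow N, rFactor p

/-- `log r(p)` at primes, `0` elsewhere. [folklore] -/
def logR (n : ℕ) : ℝ := if n.Prime then Real.log (rFactor n) else 0

/-- `Rinf = ∏_p r(p) = exp(∑_p log r(p))` — Heath-Brown's `∏_p {(1 − g(p)/p) ∏_{P∣p}(1 − 1/N(P))⁻¹}`.
[cite: HeathBrown2001LargestPrimeFactorCubic, Lemma 9 (C₃)] -/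
def Rinf : ℝ := Real.exp (∑' n, logR n)

/-- Heath-Brown's constant `C₃ = Rinf / (e^γ γ₀)` (`γ₀ = ρ_K`).
[cite: HeathBrown2001LargestPrimeFactorCubic, Lemma 9 (C₃)] -/
def C3 : ℝ := Rinf / (Real.exp Real.eulerMascheroniConstant * gamma₀)

/-! ### Positivity and the size of `log r(p)` -/

/-- `1 − g(p)/p > 0` at every prime (`g ≤ 3`; `g(2) = g(3) = 1`). [folklore] -/
theorem gFactor_pos {p : ℕ} (hp : p.Prime) : 0 < gFactor p := by
  unfold gFactor
  have hp0 : (0 : ℝ) < p := by exact_mod_cast hp.pos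
  rw [sub_pos, div_lt_one hp0]
  by_cases h4 : 4 ≤ p
  · have h3 : (cubeRootTwoCount p : ℝ) ≤ 3 := by exact_mod_cast cubeRootTwoCount_le_three hp
    have : (4 : ℝ) ≤ p := by exact_mod_cast h4
    linarith
  · have h2 := hp.two_le
    interval_cases p
    · rw [cubeRootTwoCount_two]; norm_num
    · rw [cubeRootTwoCount_three]; norm_num

/-- `g(p)/p ≤ 3/7 (< 1/2)` for primes `p ≥ 7`. [folklore] -/
theorem count_div_le {p : ℕ} (hp : p.Prime) (h7 : 7 ≤ p) :
    0 ≤ (cubeRootTwoCount p : ℝ) / p ∧ (cubeRootTwoCount p : ℝ) / p ≤ 3 / p ∧ (3 : ℝ) / p ≤ 3 / 7 := by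
  have hp7 : (7 : ℝ) ≤ p := by exact_mod_cast h7
  have hp0 : (0 : ℝ) < p := by linarith
  have h3 : (cubeRootTwoCount p : ℝ) ≤ 3 := by exact_mod_cast cubeRootTwoCount_le_three hp
  exact ⟨by positivity, div_le_div_of_nonneg_right h3 hp0.le,
    div_le_div_of_nonneg_left (by norm_num) (by norm_num) hp7⟩

/-- `r(p) > 0` at primes. [folklore] -/
theorem rFactor_pos {p : ℕ} (hp : p.Prime) : 0 < rFactor p :=
  div_pos (gFactor_pos hp) (one_sub_normDensityAt_bounds hp).2.1

/-- `1 − g(p)/p = (∏_{P∣p}(1 − N(P)⁻¹)) · r(p)` at primes. [folklore] -/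
theorem gFactor_eq_mul {p : ℕ} (hp : p.Prime) : gFactor p = (1 - normDensityAt p) * rFactor p := by
  rw [rFactor, mul_div_cancel₀ _ (one_sub_normDensityAt_bounds hp).2.1.ne']

/-- `log r(p) = log(1 − g(p)/p) + b_p(1)` at primes (`∏_{P∣p}(1 − N(P)⁻¹) = e^{−b_p(1)}`). [folklore] -/
theorem log_rFactor_eq {p : ℕ} (hp : p.Prime) :
    Real.log (rFactor p) = Real.log (gFactor p) + bTerm p 1 := by
  rw [rFactor, Real.log_div (gFactor_pos hp).ne' (one_sub_normDensityAt_bounds hp).2.1.ne',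
    one_sub_normDensityAt_eq_exp hp, Real.log_exp]
  ring

/-- **`|log r(p)| ≤ 24/p²` for primes `p ≥ 7`**: `log r(p) = (log(1 − u) + u) + r_p(1)` with
`u = g(p)/p ≤ 3/p`, `|log(1 − u) + u| ≤ 2u² ≤ 18/p²` and `0 ≤ r_p(1) ≤ 6/p²`
(`CubicSieve.rTerm_bounds`). [cite: HeathBrown2001LargestPrimeFactorCubic, Lemma 9 (convergence of C₃)] -/
theorem abs_log_rFactor_le {p : ℕ} (hp : p.Prime) (h7 : 7 ≤ p) :
    |Real.log (rFactor p)| ≤ 24 / (p : ℝ) ^ 2 := by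
  have hp7 : (7 : ℝ) ≤ p := by exact_mod_cast h7
  have hp0 : (0 : ℝ) < p := by linarith
  obtain ⟨hu0, hu3, h37⟩ := count_div_le hp h7
  set u : ℝ := (cubeRootTwoCount p : ℝ) / p with hu
  -- `b_p(1) = u + r_p(1)`
  have hb : bTerm p 1 = u + rTerm p 1 := by
    rw [rTerm, if_pos hp, Real.rpow_neg_one, hu, div_eq_mul_inv]; ring
  obtain ⟨hr0, hr6⟩ := rTerm_bounds hp (le_refl (1 : ℝ))
  obtain ⟨hl0, hl2, -, -⟩ := neg_log_one_sub_bounds hu0 (by linarith)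
  have hgf : gFactor p = 1 - u := rfl
  rw [log_rFactor_eq hp, hb, hgf]
  have hu2 : 2 * u ^ 2 ≤ 18 / (p : ℝ) ^ 2 := by
    have h1 : u ^ 2 ≤ (3 / (p : ℝ)) ^ 2 := pow_le_pow_left₀ hu0 hu3 2
    have h2 : (3 / (p : ℝ)) ^ 2 = 9 / (p : ℝ) ^ 2 := by rw [div_pow]; norm_num
    have h3 : (18 : ℝ) / (p : ℝ) ^ 2 = 2 * (9 / (p : ℝ) ^ 2) := by ring
    rw [h3]
    linarith [h1.trans_eq h2]
  rw [abs_le]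
  constructor
  · have : -(24 / (p : ℝ) ^ 2) ≤ -(18 / (p : ℝ) ^ 2) := by
      apply neg_le_neg; exact div_le_div_of_nonneg_right (by norm_num) (by positivity)
    linarith
  · have : 6 / (p : ℝ) ^ 2 ≤ 24 / (p : ℝ) ^ 2 := div_le_div_of_nonneg_right (by norm_num) (by positivity)
    linarith

/-- Eventually `|logR n| ≤ 24 · (n²)⁻¹`. [folklore] -/
theorem abs_logR_le {n : ℕ} (hn : 7 ≤ n) : |logR n| ≤ 24 * ((n : ℝ) ^ 2)⁻¹ := by
  unfold logR
  split_ifs with hpr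
  · rw [← div_eq_mul_inv]; exact abs_log_rFactor_le hpr hn
  · rw [abs_zero]; positivity

/-- `logR` is summable. [folklore] -/
theorem summable_logR : Summable logR := by
  refine Summable.of_norm_bounded_eventually_nat
    ((Real.summable_nat_pow_inv.mpr one_lt_two).mul_left 24) ?_
  filter_upwards [eventually_ge_atTop 7] with n hn
  rw [Real.norm_eq_abs]
  exact abs_logR_le hn

/-- `rProd N = exp(∑_{n < N} logR n)`. [folklore] -/
theorem rProd_eq_exp_sum (N : ℕ) : rProd N = Real.exp (∑ n ∈ range N, logR n) := by
  unfold logR rProd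
  rw [← Finset.sum_filter, Real.exp_sum]
  refine Finset.prod_congr rfl fun p hp => ?_
  rw [Real.exp_log (rFactor_pos (Nat.prime_of_mem_primesBelow hp))]

/-- **The Euler product of `C₃` converges**: `∏_{p < N} r(p) → Rinf`. [cite: HeathBrown2001LargestPrimeFactorCubic, Lemma 9 (C₃)] -/
theorem tendsto_rProd : Tendsto rProd atTop (𝓝 Rinf) := by
  have hS := summable_logR.hasSum.tendsto_sum_nat
  have h := (Real.continuous_exp.tendsto _).comp hS
  refine h.congr fun N => ?_
  simp only [Function.comp_apply]
  exact (rProd_eq_exp_sum N).symm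

/-- `Rinf > 0`. [folklore] -/
theorem Rinf_pos : 0 < Rinf := Real.exp_pos _

/-- `C₃ > 0`. [folklore] -/
theorem C3_pos : 0 < C3 := div_pos Rinf_pos (mul_pos (Real.exp_pos _) gamma₀_pos)

/-! ### Lemma 9 -/

/-- The regrouping identity `∏_{p<x}(1 − g(p)/p) = (∏_{p<x}∏_{P∣p}(1 − N(P)⁻¹)) · ∏_{p<x} r(p)`.
[folklore] -/
theorem gProd_eq (x : ℝ) :
    gProd x = (∏ p ∈ Nat.primesBelow ⌈x⌉₊, (1 - normDensityAt p)) * rProd ⌈x⌉₊ := by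
  rw [gProd, rProd, ← Finset.prod_mul_distrib]
  exact Finset.prod_congr rfl fun p hp => gFactor_eq_mul (Nat.prime_of_mem_primesBelow hp)

/-- Mertens for `K`, grouped, as a limit: `(∏_{p<x}∏_{P∣p}(1 − N(P)⁻¹)) · e^γ γ₀ log x → 1`.
[cite: Rosen1999Mertens, Thm 2] -/
theorem tendsto_mertensK_grouped :
    Tendsto (fun x : ℝ => (∏ p ∈ Nat.primesBelow ⌈x⌉₊, (1 - normDensityAt p)) *
      (Real.exp Real.eulerMascheroniConstant * gamma₀ * Real.log x)) atTop (𝓝 1) := by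
  obtain ⟨C, z₀, h⟩ := mertensK_grouped
  have h0 : Tendsto (fun x : ℝ => C / Real.log x) atTop (𝓝 0) :=
    tendsto_const_nhds.div_atTop Real.tendsto_log_atTop
  have h1 : Tendsto (fun x : ℝ => (∏ p ∈ Nat.primesBelow ⌈x⌉₊, (1 - normDensityAt p)) *
      (Real.exp Real.eulerMascheroniConstant * gamma₀ * Real.log x) - 1) atTop (𝓝 0) := by
    refine squeeze_zero_norm' ?_ h0
    filter_upwards [eventually_ge_atTop z₀] with x hx
    rw [Real.norm_eq_abs]
    exact h x hx
  have h2 := h1.add_const 1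
  simp only [sub_add_cancel, zero_add] at h2
  exact h2

/-- **Heath-Brown 2001 (PLMS), Lemma 9**: `∏_{p<x} (1 − g(p)/p) ∼ C₃/log x`, i.e.
`(∏_{p<x}(1 − g(p)/p)) · log x → C₃ = Rinf/(e^γ γ₀)` as `x → ∞`.
[cite: HeathBrown2001LargestPrimeFactorCubic, Lemma 9] -/
theorem tendsto_gProd_mul_log : Tendsto (fun x : ℝ => gProd x * Real.log x) atTop (𝓝 C3) := by
  set E : ℝ := Real.exp Real.eulerMascheroniConstant * gamma₀ with hE
  have hE0 : E ≠ 0 := (mul_pos (Real.exp_pos _) gamma₀_pos).ne'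
  have hR : Tendsto (fun x : ℝ => rProd ⌈x⌉₊) atTop (𝓝 Rinf) := tendsto_rProd.comp tendsto_nat_ceil_atTop
  have hM := tendsto_mertensK_grouped
  have h := (hM.mul hR).div_const E
  rw [one_mul] at h
  refine h.congr fun x => ?_
  rw [gProd_eq x]
  field_simp
  ring

/-- `ε`-form of Lemma 9: for every `ε > 0`, eventually `|(∏_{p<x}(1 − g(p)/p)) log x − C₃| ≤ ε`.
[cite: HeathBrown2001LargestPrimeFactorCubic, Lemma 9] -/
theorem eventually_abs_gProd_mul_log_sub_le {ε : ℝ} (hε : 0 < ε) :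
    ∀ᶠ x : ℝ in atTop, |gProd x * Real.log x - C3| ≤ ε := by
  have h := (tendsto_gProd_mul_log.sub_const C3)
  rw [sub_self] at h
  have h' := Metric.tendsto_nhds.mp h ε hε
  filter_upwards [h'] with x hx
  rw [Real.dist_eq, sub_zero] at hx
  exact hx.le

/-- `√27 = 3√3`. [folklore] -/
theorem sqrt_twentySeven : Real.sqrt 27 = 3 * Real.sqrt 3 := by
  rw [show (27 : ℝ) = 3 ^ 2 * 3 by norm_num, Real.sqrt_mul (by norm_num), Real.sqrt_sq (by norm_num)]

/-- **The printed shape of the constant**: `C₃ = √27/(e^γ π log ε₀) · Rinf`, by the class number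
formula `γ₀ = π log ε₀/(3√3)` (`CubicSieve.gamma₀_eq`; `ε₀ = unitE`, `log ε₀ = R_K`).
[cite: HeathBrown2001LargestPrimeFactorCubic, Lemma 9 (C₃)] -/
theorem C3_eq : C3 = Real.sqrt 27 / (Real.exp Real.eulerMascheroniConstant * Real.pi * Real.log unitE) * Rinf := by
  rw [C3, gamma₀_eq, sqrt_twentySeven]
  have hπ : Real.pi ≠ 0 := Real.pi_pos.ne'
  have hlog : Real.log unitE ≠ 0 := log_unitE_pos.ne'
  have h3 : Real.sqrt 3 ≠ 0 := (Real.sqrt_pos.mpr (by norm_num)).ne'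
  have he : Real.exp Real.eulerMascheroniConstant ≠ 0 := (Real.exp_pos _).ne'
  field_simp

end Literature.NumberTheory.Sieve.HeathBrown2001
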